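import Summits.QuantumFields.YangMills.Theorems.UnitScaleTiltBlockAvgCorrector
import Literature.MathematicalPhysics.QuantumFieldTheory.Balaban1983to89.T3SmallLiftHistory
import HarnessLib

/-!
# Route `UnitScaleTilt` (rung R3), crux K1bR-pr «FluctuationComparisonRegPr» (stmt-QuantumFields-19201), stub `stub_oneStepSmallLift` (W7, S-C):
# EXACTNESS IS FREE — `OneStepSmallLift F ℰp κ δ₀′` FOLLOWS FROM APPROXIMATE ONE-STEP LIFTS WITH GAIN `κ₀ < κ` AND A QUADRATIC AVERAGING
# DEFECT, by the exact corrector of `UnitScaleTiltBlockAvgCorrector`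

Cell `ym3-torus` (HUMAN RULING D-0037, YM ladder rung R3), seat `ym3-torus-p1` gen 9; cell record HOME/UV3-NODE.md §18.  WHAT THIS IS NOT: no lift
is constructed and nothing of Bałaban's is asserted (Bałaban never needs (0.4) to be onto the small fields); the approximate lift is a HYPOTHESIS,
spelled out in the theorem, and the theorem is the kernel-checked reduction of the registered stub's schema `T3SmallLiftHistory.OneStepSmallLift`
to it.

THE POINT.  `stub_oneStepSmallLift` asks `∀ L, ∃ κ δ₀, κ√L ≤ 1 ∧ 0 < δ₀ ∧ ∀ F, F.L = L → OneStepSmallLift F ℰp κ δ₀`: every `δ`-small coarse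
field (`δ ≤ δ₀`) IS the (0.4) average of a `κδ`-small fine field.  Its linear core is certified (WATCH W7: `κ_lin(3) = 0.4656`, Whitney form
`8L⁴/(L²+1)³` for odd `L ≥ 5`); the non-linear reading of a linear lift reproduces the datum only up to `O(δ²)` bond by bond.
**`oneStepSmallLift_of_approx`**: if for every member of the family with block size `L`, every torus in the standing range and every
`δ ∈ (0, δ₀]`, every `δ`-small `V` has a `κ₀δ`-small `U` with `‖Ū(c) − V(c)‖ ≤ C₄δ²` for all coarse bonds `c`, and `κ₀ < κ`, then
`OneStepSmallLift F ℰp κ δ₀′` for all such `F`, with `δ₀′ = min δ₀ (min 1 (min (t₀/(κ₀ + CC₄ + 1)) ((κ − κ₀)/(4CC₄ + 1))))` (`t₀, C` the exact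
corrector's constants at block size `L`, `BlockAvgCorrector.exists_corrector_T3`): the corrector makes the lift exact at the price
`4CC₄δ² ≤ (κ − κ₀)δ` on the plaquettes.  So S-C's located content is the APPROXIMATE non-linear small lift with any gain `κ₀ < L^{-1/2}`.

References: T. Bałaban, CMP 109 (1987) 249–301 [Balaban1987RG1] ((0.4), (0.18) p.253–255).
-/

noncomputable section

open scoped Matrix.Norms.L2Operator

namespace Summit.QuantumFields.YangMills.Theorems.BlockAvgCorrector

open Literature.MathematicalPhysics.QuantumFieldTheory.Balaban1983to89
open BlockAveraging T3ContinuumYM3Torus T3SmallLiftHistory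
open T3UnitLawDensityEML (ℰp)

/-- **EXACTNESS IS FREE FOR THE ONE-STEP SMALL LIFT.**  Approximate one-step lifts with gain `κ₀` and averaging defect `C₄δ²` for all
`δ ≤ δ₀` on every torus of every member of the family with block size `L`, together with `κ₀ < κ`, give `OneStepSmallLift F ℰp κ δ₀′` for an
explicit `δ₀′ > 0` depending on `L, κ₀, κ, C₄, δ₀` alone. [cite: Balaban1987RG1, (0.4)/(0.18) p.253] -/
theorem oneStepSmallLift_of_approx (L : ℕ) {κ₀ κ C₄ δ₀ : ℝ} (hκ₀ : 0 ≤ κ₀) (hκ : κ₀ < κ) (hC₄ : 0 ≤ C₄) (hδ₀ : 0 < δ₀)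
    (happ : ∀ F : T3Family, F.L = L → ∀ (K j : ℕ), j + 1 ≤ F.m + K → ∀ δ : ℝ, 0 < δ → δ ≤ δ₀ →
      ∀ V : GaugeField (F.P K) (j + 1) (Matrix.specialUnitaryGroup (Fin 2) ℂ), PlaqSmall δ V →
        ∃ U : GaugeField (F.P K) j (Matrix.specialUnitaryGroup (Fin 2) ℂ), PlaqSmall (κ₀ * δ) U ∧
          ∀ c, ‖((avgFun ℰp U c : Matrix.specialUnitaryGroup (Fin 2) ℂ) : Matrix (Fin 2) (Fin 2) ℂ) -
            ((V c : Matrix.specialUnitaryGroup (Fin 2) ℂ) : Matrix (Fin 2) (Fin 2) ℂ)‖ ≤ C₄ * δ ^ 2) :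
    ∃ δ₀' : ℝ, 0 < δ₀' ∧ ∀ F : T3Family, F.L = L → OneStepSmallLift F ℰp κ δ₀' := by
  obtain ⟨t₀, C, ht₀, hC, hcorr⟩ := exists_corrector_T3 L
  have hden₁ : 0 < κ₀ + C * C₄ + 1 := by positivity
  have hden₂ : 0 < 4 * C * C₄ + 1 := by positivity
  set δ₀' : ℝ := min δ₀ (min 1 (min (t₀ / (κ₀ + C * C₄ + 1)) ((κ - κ₀) / (4 * C * C₄ + 1)))) with hδ₀'_def
  have hδ₀'pos : 0 < δ₀' := lt_min hδ₀ (lt_min one_pos (lt_min (div_pos ht₀ hden₁) (div_pos (by linarith) hden₂)))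
  have hδ₀'δ₀ : δ₀' ≤ δ₀ := min_le_left _ _
  have hδ₀'1 : δ₀' ≤ 1 := (min_le_right _ _).trans (min_le_left _ _)
  have hδ₀'t : δ₀' ≤ t₀ / (κ₀ + C * C₄ + 1) := (min_le_right _ _).trans ((min_le_right _ _).trans (min_le_left _ _))
  have hδ₀'κ : δ₀' ≤ (κ - κ₀) / (4 * C * C₄ + 1) := (min_le_right _ _).trans ((min_le_right _ _).trans (min_le_right _ _))
  refine ⟨δ₀', hδ₀'pos, fun F hFL K j hj δ hδ hδδ₀' V hV => ?_⟩
  have hj' : j + 1 ≤ F.m + K := hj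
  have hδ1 : δ ≤ 1 := hδδ₀'.trans hδ₀'1
  obtain ⟨U, hUsmall, hUV⟩ := happ F hFL K j hj' δ hδ (hδδ₀'.trans hδ₀'δ₀) V hV
  -- the corrector's smallness: `κ₀δ + C·C₄δ² ≤ (κ₀ + CC₄ + 1)δ₀′ ≤ t₀`
  have hCC₄ : 0 ≤ C * C₄ := mul_nonneg hC hC₄
  have hδsq : δ ^ 2 ≤ δ := by nlinarith
  have hsmall : κ₀ * δ + C * (C₄ * δ ^ 2) ≤ t₀ := by
    have h1 : κ₀ * δ + C * (C₄ * δ ^ 2) ≤ (κ₀ + C * C₄ + 1) * δ₀' := by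
      nlinarith [mul_le_mul_of_nonneg_left hδsq hCC₄, mul_le_mul_of_nonneg_left hδδ₀' hκ₀, mul_le_mul_of_nonneg_left hδδ₀' hCC₄]
    have h2 : (κ₀ + C * C₄ + 1) * δ₀' ≤ t₀ := by
      have := mul_le_mul_of_nonneg_left hδ₀'t hden₁.le
      rwa [mul_div_cancel₀ _ hden₁.ne'] at this
    linarith
  have hVU : ∀ c, ‖((V c : Matrix.specialUnitaryGroup (Fin 2) ℂ) : Matrix (Fin 2) (Fin 2) ℂ) -
      ((avgFun ℰp U c : Matrix.specialUnitaryGroup (Fin 2) ℂ) : Matrix (Fin 2) (Fin 2) ℂ)‖ ≤ C₄ * δ ^ 2 := fun c => by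
    rw [norm_sub_rev]; exact hUV c
  obtain ⟨U', hU'V, -, -, hU'small⟩ :=
    hcorr F hFL K j hj' (κ₀ * δ) (C₄ * δ ^ 2) (by positivity) (by positivity) hsmall U hUsmall V hVU
  refine ⟨U', by rw [blockAvg_avg]; exact hU'V, fun p => (hU'small p).trans_le ?_⟩
  -- `κ₀δ + 4C·C₄δ² ≤ κδ` since `4CC₄δ ≤ (4CC₄ + 1)δ₀′ ≤ κ − κ₀`
  have h3 : 4 * C * C₄ * δ ≤ κ - κ₀ := by
    have h4 : 4 * C * C₄ * δ ≤ (4 * C * C₄ + 1) * δ₀' := by nlinarith [mul_le_mul_of_nonneg_left hδδ₀' hCC₄]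
    have h5 : (4 * C * C₄ + 1) * δ₀' ≤ κ - κ₀ := by
      have := mul_le_mul_of_nonneg_left hδ₀'κ hden₂.le
      rwa [mul_div_cancel₀ _ hden₂.ne'] at this
    linarith
  nlinarith [mul_le_mul_of_nonneg_right h3 hδ.le]

end Summit.QuantumFields.YangMills.Theorems.BlockAvgCorrector

end
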